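import Literature.MathematicalPhysics.QuantumFieldTheory.Balaban1983to89.B9TaxiTransportLadder
import Literature.MathematicalPhysics.QuantumFieldTheory.Balaban1983to89.B9Eq335CoveragePAtLettersY
import Literature.MathematicalPhysics.QuantumFieldTheory.Balaban1983to89.B9BackgroundsKLevelV1R

/-!
# `Balaban1983to89.B9PlaquetteBinderOfReg335Y` — T. Bałaban, *Propagators for lattice gauge theories in a background field*, Commun. Math. Phys. **99** (1985)
# 389–434 [Balaban1985BackgroundPropagators] (3.35) p. 396 with (3.69) p. 404 («|U(∂p) − 1| ≤ O(1)Mα₀(Lʲη)⁻² … follow directly from the assumptions (3.35)»):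
# THE PLAQUETTE BINDER `hF` OF THE TRANSPORTED J-LETTER (`B9GradViaDivLettersTransported.hasMaj_JcoKH_taxi`, binder on the ORDERED-pair plaquette variable
# `B9TaxiTransportLadder.plaqV U y μ ν` at EVERY `(μ, ν)`) DERIVED from def-Y's member class `(bg9YP … x).Reg335 c35Y α₀ U` over print's cube class

statement-level skeleton of published theorems with citation tags; proofs where landed; nothing here is a claim about the Yang–Mills mass gap

PDF held: `paper:balaban1985-cmp99-background-propagators` (journal page = PDF page + 388); pp. 395–396, 404 read by this seat (2026-08-28).

THE PRINT (verbatim, p. 404, (3.69) and after): *«This bound follows from the estimates |Re U(∂p) − 1| ≤ O(1)Mα₀(Lʲη)⁻², |Im U(∂p)| ≤ O(1)Mα₀(Lʲη)⁻² for p ⊂ Bʲ,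
and the estimates follow directly from the assumptions (3.35), (3.37).»*  p. 396, (3.35): *«… for a configuration U there exists a gauge transformation u on □ such
that U^u = e^{iηA} …»* — the plaquette variables `U(∂p)` are gauge-COVARIANT, so their distance to `1` is a gauge-INVARIANT datum of the class.

WHY THIS FILE (cell context, dag-n06-l g21, OPTION (2) of the knit's WORD-TZ).  The transported J-letter `hasMaj_JcoKH_taxi` (this seat, `B9GradViaDivLettersTransported`)
between the transported Hölder classes carries exactly two configuration binders: `hU` (links contracting — the knit's `hUG` currency) and the plaquette binder
`hF : ∀ y μ′ ν′, ‖plaqV U y μ′ ν′ − 1‖ ≤ ϑF·(L^{levY (chartY y)})⁻¹` on the ORDERED-pair plaquette variable of the ladder lemma (`μ′ = ν′` and `μ′ > ν′` included).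
n06-j's `B9Eq335CoveragePAtLettersY.norm_holY_sub_one_le_levelled_of_regYP335_c35Y` bounds def-Y's `holY U p` (plaquettes `p` with `μ < ν`) from the member class over
PRINT's cube class by `C₀·((L^{lev x − 1})⁻¹)²`, `C₀ = 2K(1+K)e^{4K}`, `K = 10L·(M·α₀)`.  This file closes the bookkeeping gap between the two shapes: `plaqV` at `μ = ν`
is `1`, at `μ > ν` it is the INVERSE of `holY` (same distance to `1` for contracting links), at `μ < ν` it IS `holY`; and `(L^{lev−1})⁻² ≤ L·(L^{lev})⁻¹` (`lev ≥ 1`).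
Hence **`hF` follows from class membership plus ANY levelled plaquette bound `Θ·((L^{lev x − 1})⁻¹)²`** with `ϑF := Θ·L` (`plaqV_binder_of_regYP335_levelled`); at the
P-class premise the levelled bound is n06-j's theorem, so there `hF` is DERIVED: `hF := plaqV_binder_of_regYP335_levelled x hG h hC₀ (fun p =>
B9Eq335CoveragePAtLettersY.norm_holY_sub_one_le_levelled_of_regYP335_c35Y x hα₀ h p)` (a composition, not restated as a declaration here).  (At MODULE 3's
`bg9Y ∕ cubeClass396` premise the coverage of every plaquette is NOT a theorem — n06-j `B9Eq335CoverageAtLettersY` (uncovered bonds) — and `hF` stays displayed there;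
that class choice is def-Y's ∕ the knit's, not this file's.)
PRIOR ART DECLARED.  The levelled plaquette estimate is n06-j's (consumed as a HYPOTHESIS in its printed shape); the contraction of `G`-valued links for `G ≤ U(N)` is the tree's
`CStarRing.norm_of_mem_unitary` reading (as in `B13GreenPrimeSymLettersOfReg335.norm_unit_le_one_of_mem`, not restated as a declaration); `plaqV` is this seat's
`B9TaxiTransportLadder.plaqV`; `levY ∘ chartY = levV1` is definitional (`B9Thm310CommutatorDataOfPlaquettes.levY_chartY`, `rfl`, not imported).

WHAT IS PROVED (sorry-free; 0 `def`; nothing of [B9] asserted).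
* §1 (any normed ring): `plaqV_self` (`plaqV U z μ μ = 1`), `plaqV_swap` (`plaqV U z ν μ = (plaqV U z μ ν)⁻¹`), `plaqV_eq_holY` (`rfl` at def-Y's `PlaqY`),
  `norm_plaqV_le_one` (contracting links), ★ `norm_plaqV_sub_one_le_of_holY` (a bound `Φ(src) ≥ 0` on `‖holY U p − 1‖` over def-Y's plaquettes bounds
  `‖plaqV U z μ ν − 1‖` at EVERY ordered pair), ★★ `plaqV_binder_of_levelled` (n06-j's levelled shape `Θ·((L^{levV1 src − 1})⁻¹)²` ⇒ the J-letter's shape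
  `(Θ·L)·(L^{levY (chartY src)})⁻¹`).
* §2 (`𝔸 = M_N(ℂ)`, operator norm, `N ≥ 1`, `G ≤ U(N)`): `contractive_of_regYP335` (the J-letter's `hU` from class membership), ★★★ **`plaqV_binder_of_regYP335_levelled`**
  — for `U` in def-Y's member class `(bg9YP (M_N(ℂ)) G x).Reg335 c α₀` and a levelled plaquette bound `Θ·((L^{levV1 src − 1})⁻¹)²` over def-Y's plaquettes (n06-j's
  printed shape, `Θ ≥ 0`): `∀ y μ ν, ‖plaqV U y μ ν − 1‖ ≤ (Θ·L)·(L^{levY (chartY y)})⁻¹` — the J-letter's `hF` with `ϑF := Θ·L`.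
MODEL ∕ DECLARED READINGS.  def-Y's letters at a member `x` (`PlaqY`, `holY`, `CfgY = CfgV1`, `levV1`, `chartY ∕ levY`), n06-j's constant as the witness for print's
`O(1)Mα₀`; the scale factor is weakened from `(Lʲη)⁻²·η²`-shape `L^{−2(j−1)}` to `L·L^{−j}` (all the J-letter needs).  DISPLAYED: nothing beyond class membership.
HONEST SCOPE.  Bookkeeping over landed definitions and n06-j's landed estimate; NOT a node discharge, NOT summit progress; count-neutral; nothing continuum ∕ OS ∕
mass gap ∕ Clay.  Cell `pub-ymgap` (HUMAN RULING D-0062), Track A node N06 [B9], seat `pub-ymgap-dag-n06-l` (bundle F7 rows 20–21; gen 21), 2026-08-28.  NEW file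
importing this seat's `B9TaxiTransportLadder` and n06-j's `B9Eq335CoveragePAtLettersY`; nothing landed is modified.  Net new unproved facts: 0.
v1.1 (gen 23, 2026-08-28): §3 appended — the composition announced above LANDED as declarations (n06-j's levelled bound plugged in; the member-UNIFORM budget under the
regime `M·α₀ ≤ a₀`; the R-generic member-∀ form in the N06 certificate's binder shape); one import added (`B9BackgroundsKLevelV1R`); §1–§2 byte-identical; still 0 `def`.
-/

noncomputable section

namespace Literature.MathematicalPhysics.QuantumFieldTheory.Balaban1983to89.B9PlaquetteBinderOfReg335Y

open B9BackgroundsKLevelV1 (CfgV1 levV1 levV1_pos)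
open B9TaxiTransportLadder (plaqV)
open B6KLevelCensusIndexV1 B6GlobalChartV1 Node00 B9BackgroundsKLevelV1P B9PinMembersKLevelV1
open B9PinGeometryKLevelV1 (c35Y)
open Node00.OpsYNablaBridge (chartY)

/-! ## §1 The ordered-pair plaquette variable against def-Y's plaquettes -/

section Generic

variable {P : Params} {𝔸 : Type} [NormedRing 𝔸]

/-- the degenerate ordered pair: `plaqV U z μ μ = U_μ(z)U_μ(z+e_μ)U_μ(z+e_μ)⁻¹U_μ(z)⁻¹ = 1`. [cite: Balaban1985BackgroundPropagators, (3.1) p.390 (U(∂p)), bookkeeping] -/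
theorem plaqV_self (U : CfgV1 P 𝔸) (z : Site P 0) (μ : Fin P.d) : plaqV U z μ μ = 1 := by
  unfold plaqV
  group

/-- reversing the orientation inverts the plaquette variable: `plaqV U z ν μ = (plaqV U z μ ν)⁻¹`. [cite: Balaban1985BackgroundPropagators, (3.5) p.391 (U(b⁻¹) = U(b)⁻¹), bookkeeping] -/
theorem plaqV_swap (U : CfgV1 P 𝔸) (z : Site P 0) (μ ν : Fin P.d) : plaqV U z ν μ = (plaqV U z μ ν)⁻¹ := by
  unfold plaqV
  group

/-- for contracting links the plaquette variable is a contraction: `‖plaqV U z μ ν‖ ≤ 1`. [cite: Balaban1985BackgroundPropagators, (3.35) p.396 (U with values in G), bookkeeping] -/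
theorem norm_plaqV_le_one {U : CfgV1 P 𝔸} (hU : ∀ (ν : Fin P.d) (y : Site P 0), ‖(U ν y : 𝔸)‖ ≤ 1 ∧ ‖(((U ν y)⁻¹ : 𝔸ˣ) : 𝔸)‖ ≤ 1)
    (z : Site P 0) (μ ν : Fin P.d) : ‖(plaqV U z μ ν : 𝔸)‖ ≤ 1 := by
  unfold plaqV
  rw [Units.val_mul, Units.val_mul, Units.val_mul]
  have h1 := (hU μ z).1
  have h2 := (hU ν (z.shift μ)).1
  have h3 := (hU μ (z.shift ν)).2
  have h4 := (hU ν z).2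
  calc _ ≤ ‖(U μ z : 𝔸) * (U ν (z.shift μ) : 𝔸) * (((U μ (z.shift ν))⁻¹ : 𝔸ˣ) : 𝔸)‖ * ‖(((U ν z)⁻¹ : 𝔸ˣ) : 𝔸)‖ := norm_mul_le _ _
    _ ≤ ‖(U μ z : 𝔸) * (U ν (z.shift μ) : 𝔸)‖ * ‖(((U μ (z.shift ν))⁻¹ : 𝔸ˣ) : 𝔸)‖ * ‖(((U ν z)⁻¹ : 𝔸ˣ) : 𝔸)‖ :=
        mul_le_mul_of_nonneg_right (norm_mul_le _ _) (norm_nonneg _)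
    _ ≤ ‖(U μ z : 𝔸)‖ * ‖(U ν (z.shift μ) : 𝔸)‖ * ‖(((U μ (z.shift ν))⁻¹ : 𝔸ˣ) : 𝔸)‖ * ‖(((U ν z)⁻¹ : 𝔸ˣ) : 𝔸)‖ :=
        mul_le_mul_of_nonneg_right (mul_le_mul_of_nonneg_right (norm_mul_le _ _) (norm_nonneg _)) (norm_nonneg _)
    _ ≤ 1 * 1 * 1 * 1 := by gcongr
    _ = 1 := by norm_num

end Generic

section Letters

variable {d ℓ : ℕ} {hd : 1 ≤ d + 1} {hL : Odd (ℓ + 1) ∧ 1 < ℓ + 1} {b₀ b₁ : ℝ}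
variable (i : KIdx d ℓ hd hL b₀ b₁) {𝔸 : Type} [NormedRing 𝔸] [NormedAlgebra ℂ 𝔸] [CompleteSpace 𝔸]

/-- at def-Y's plaquettes (`μ < ν`) the ordered-pair plaquette variable IS def-Y's `holY` (the same four-link product).
[cite: Balaban1985BackgroundPropagators, (3.1) p.390 (U(∂p)), dictionary] -/
theorem plaqV_eq_holY (U : CfgY 𝔸 i) (p : PlaqY i) : plaqV U p.src p.μ p.ν = holY i U p := rfl

/-- ★ a bound `Φ(src) ≥ 0` on `‖U(∂p) − 1‖` over def-Y's plaquettes bounds the ORDERED-pair plaquette variable at every `(μ, ν)`, for contracting links: `μ = ν` gives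
`0`, `μ < ν` is `holY`, `μ > ν` is `holY⁻¹` with `‖W⁻¹ − 1‖ = ‖W⁻¹(1 − W)‖ ≤ ‖W − 1‖`. [cite: Balaban1985BackgroundPropagators, (3.69) p.404, (3.5) p.391, bookkeeping] -/
theorem norm_plaqV_sub_one_le_of_holY {U : CfgY 𝔸 i}
    (hU : ∀ (ν : Fin (PV d ℓ i.m i.K hd hL).d) (y : Site (PV d ℓ i.m i.K hd hL) 0), ‖(U ν y : 𝔸)‖ ≤ 1 ∧ ‖(((U ν y)⁻¹ : 𝔸ˣ) : 𝔸)‖ ≤ 1)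
    {Φ : Site (PV d ℓ i.m i.K hd hL) 0 → ℝ} (hΦ : ∀ z, 0 ≤ Φ z) (hhol : ∀ p : PlaqY i, ‖((holY i U p : 𝔸ˣ) : 𝔸) - 1‖ ≤ Φ p.src)
    (z : Site (PV d ℓ i.m i.K hd hL) 0) (μ ν : Fin (PV d ℓ i.m i.K hd hL).d) : ‖(plaqV U z μ ν : 𝔸) - 1‖ ≤ Φ z := by
  rcases lt_trichotomy μ ν with h | h | h
  · exact hhol ⟨z, μ, ν, h⟩
  · subst h
    rw [plaqV_self, Units.val_one, sub_self, norm_zero]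
    exact hΦ z
  · -- `μ > ν`: the inverse of def-Y's plaquette `⟨z, ν, μ⟩`
    rw [plaqV_swap]
    set W : 𝔸ˣ := plaqV U z ν μ with hW
    have hWi : ‖((W⁻¹ : 𝔸ˣ) : 𝔸)‖ ≤ 1 := by
      rw [hW, ← plaqV_swap]
      exact norm_plaqV_le_one hU z μ ν
    have hid : ((W⁻¹ : 𝔸ˣ) : 𝔸) - 1 = ((W⁻¹ : 𝔸ˣ) : 𝔸) * (1 - (W : 𝔸)) := by
      rw [mul_sub, mul_one, Units.inv_mul]
    calc ‖((W⁻¹ : 𝔸ˣ) : 𝔸) - 1‖ = ‖((W⁻¹ : 𝔸ˣ) : 𝔸) * (1 - (W : 𝔸))‖ := by rw [hid]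
      _ ≤ ‖((W⁻¹ : 𝔸ˣ) : 𝔸)‖ * ‖1 - (W : 𝔸)‖ := norm_mul_le _ _
      _ ≤ 1 * ‖1 - (W : 𝔸)‖ := mul_le_mul_of_nonneg_right hWi (norm_nonneg _)
      _ = ‖(W : 𝔸) - 1‖ := by rw [one_mul, norm_sub_rev]
      _ ≤ Φ z := hhol ⟨z, ν, μ, h⟩

/-- ★★ **n06-j's LEVELLED SHAPE ⇒ THE J-LETTER's SHAPE**: a plaquette bound `Θ·((L^{levV1 src − 1})⁻¹)²` over def-Y's plaquettes (`Θ ≥ 0`, contracting links) gives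
`‖plaqV U y μ ν − 1‖ ≤ (Θ·L)·(L^{levY (chartY y)})⁻¹` at every ordered pair — `levY ∘ chartY = levV1` definitionally, `lev ≥ 1`, and `(L^{lev−1})⁻² ≤ (L^{lev−1})⁻¹ =
L·(L^{lev})⁻¹`. [cite: Balaban1985BackgroundPropagators, (3.69) p.404 («for p ⊂ Bʲ»), bookkeeping] -/
theorem plaqV_binder_of_levelled {U : CfgY 𝔸 i}
    (hU : ∀ (ν : Fin (PV d ℓ i.m i.K hd hL).d) (y : Site (PV d ℓ i.m i.K hd hL) 0), ‖(U ν y : 𝔸)‖ ≤ 1 ∧ ‖(((U ν y)⁻¹ : 𝔸ˣ) : 𝔸)‖ ≤ 1)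
    {Θ : ℝ} (hΘ : 0 ≤ Θ)
    (hhol : ∀ p : PlaqY i, ‖((holY i U p : 𝔸ˣ) : 𝔸) - 1‖ ≤ Θ * (((((ℓ + 1 : ℕ) : ℝ)) ^ (levV1 i p.src - 1))⁻¹) ^ 2)
    (y : Site (PV d ℓ i.m i.K hd hL) 0) (μ ν : Fin (PV d ℓ i.m i.K hd hL).d) :
    ‖(plaqV U y μ ν : 𝔸) - 1‖ ≤ Θ * (((ℓ + 1 : ℕ) : ℝ)) * ((((ℓ + 1 : ℕ) : ℝ)) ^ levY i (chartY i y))⁻¹ := by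
  have hL1 : (1 : ℝ) ≤ ((ℓ + 1 : ℕ) : ℝ) := by exact_mod_cast Nat.succ_le_succ (Nat.zero_le ℓ)
  have hL0 : (0 : ℝ) < ((ℓ + 1 : ℕ) : ℝ) := lt_of_lt_of_le one_pos hL1
  -- the arithmetic `Θ·((L^{lev−1})⁻¹)² ≤ Θ·L·(L^{lev})⁻¹` at every site
  have harith : ∀ z : Site (PV d ℓ i.m i.K hd hL) 0,
      Θ * (((((ℓ + 1 : ℕ) : ℝ)) ^ (levV1 i z - 1))⁻¹) ^ 2 ≤ Θ * (((ℓ + 1 : ℕ) : ℝ)) * ((((ℓ + 1 : ℕ) : ℝ)) ^ levY i (chartY i z))⁻¹ := by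
    intro z
    have hlev : levY i (chartY i z) = levV1 i z := rfl
    rw [hlev]
    set a : ℝ := (((ℓ + 1 : ℕ) : ℝ)) ^ (levV1 i z - 1) with ha
    have ha1 : 1 ≤ a := one_le_pow₀ hL1
    have ha0 : 0 < a := lt_of_lt_of_le one_pos ha1
    have hpow : (((ℓ + 1 : ℕ) : ℝ)) ^ levV1 i z = (((ℓ + 1 : ℕ) : ℝ)) * a := by
      have h1 := levV1_pos i z
      rw [ha, ← pow_succ', Nat.sub_add_cancel h1]
    rw [hpow, mul_inv, ← mul_assoc, mul_assoc Θ, mul_inv_cancel₀ hL0.ne', mul_one]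
    -- `Θ·(a⁻¹)² ≤ Θ·a⁻¹` for `a ≥ 1`
    have hinv1 : a⁻¹ ≤ 1 := inv_le_one_of_one_le₀ ha1
    have hinv0 : 0 ≤ a⁻¹ := inv_nonneg.2 ha0.le
    have hsq : (a⁻¹) ^ 2 ≤ a⁻¹ := by nlinarith
    exact mul_le_mul_of_nonneg_left hsq hΘ
  have hΦ0 : ∀ z : Site (PV d ℓ i.m i.K hd hL) 0, 0 ≤ Θ * (((ℓ + 1 : ℕ) : ℝ)) * ((((ℓ + 1 : ℕ) : ℝ)) ^ levY i (chartY i z))⁻¹ := fun z => by positivity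
  exact norm_plaqV_sub_one_le_of_holY i hU hΦ0 (fun p => (hhol p).trans (harith p.src)) y μ ν

end Letters

/-! ## §2 At the fibre `M_N(ℂ)`: the binder from def-Y's member class over print's cube class -/

section Member

open scoped Matrix.Norms.L2Operator

variable {d ℓ : ℕ} {hd : 1 ≤ d + 1} {hL : Odd (ℓ + 1) ∧ 1 < ℓ + 1} {b₀ b₁ : ℝ} {Mstar N : ℕ}

/-- the links of a configuration in def-Y's member class are contractions when `G ≤ U(N)` (the class records `U(b) ∈ G`; unitaries have operator norm `1`).
[cite: Balaban1985BackgroundPropagators, (3.35) p.396 (U, u with values in G), bookkeeping] -/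
theorem contractive_of_regYP335 [Nonempty (Fin N)] (x : MemberY d ℓ hd hL b₀ b₁ Mstar) {G : Subgroup (Matrix (Fin N) (Fin N) ℂ)ˣ}
    (hG : G ≤ B7Prop2Explicit.unitaryUnits (Matrix (Fin N) (Fin N) ℂ)) {U : (bg9YP (Matrix (Fin N) (Fin N) ℂ) G x).Cfg} {c α₀ : ℝ}
    (h : (bg9YP (Matrix (Fin N) (Fin N) ℂ) G x).Reg335 c α₀ U) (ν : Fin (PV d ℓ x.m x.K hd hL).d) (y : Site (PV d ℓ x.m x.K hd hL) 0) :
    ‖(U ν y : Matrix (Fin N) (Fin N) ℂ)‖ ≤ 1 ∧ ‖(((U ν y)⁻¹ : (Matrix (Fin N) (Fin N) ℂ)ˣ) : Matrix (Fin N) (Fin N) ℂ)‖ ≤ 1 := by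
  have hUG : U ν y ∈ G := h.1.1 ν y
  exact ⟨(CStarRing.norm_of_mem_unitary (B7Prop2Explicit.mem_unitaryUnits.1 (hG hUG))).le,
    (CStarRing.norm_of_mem_unitary (B7Prop2Explicit.mem_unitaryUnits.1 (hG (G.inv_mem hUG)))).le⟩

/-- ★★★ **THE J-LETTER's PLAQUETTE BINDER `hF` AT THE MEMBER CLASS, FROM A LEVELLED PLAQUETTE BOUND**: for `U` in def-Y's member class
`(bg9YP (M_N(ℂ)) G x).Reg335 c α₀` (`G ≤ U(N)`, `N ≥ 1`) and a levelled bound `‖U(∂p) − 1‖ ≤ Θ·((L^{levV1 x − 1})⁻¹)²` over def-Y's plaquettes (`Θ ≥ 0`; at `c = c35Y`,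
`α₀ ≥ 0` this is n06-j's `B9Eq335CoveragePAtLettersY.norm_holY_sub_one_le_levelled_of_regYP335_c35Y` with `Θ = 2K(1+K)e^{4K}`, `K = 10L·(M·α₀)`), EVERY ordered pair of
directions at every site has `‖plaqV U y μ ν − 1‖ ≤ (Θ·L)·(L^{levY (chartY y)})⁻¹` — the binder `hF` of `B9GradViaDivLettersTransported.hasMaj_JcoKH_taxi` with `ϑF := Θ·L`.
[cite: Balaban1985BackgroundPropagators, (3.69) p.404, (3.35) p.396] -/
theorem plaqV_binder_of_regYP335_levelled [Nonempty (Fin N)] (x : MemberY d ℓ hd hL b₀ b₁ Mstar) {G : Subgroup (Matrix (Fin N) (Fin N) ℂ)ˣ}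
    (hG : G ≤ B7Prop2Explicit.unitaryUnits (Matrix (Fin N) (Fin N) ℂ)) {U : (bg9YP (Matrix (Fin N) (Fin N) ℂ) G x).Cfg} {c α₀ : ℝ}
    (h : (bg9YP (Matrix (Fin N) (Fin N) ℂ) G x).Reg335 c α₀ U) {Θ : ℝ} (hΘ : 0 ≤ Θ)
    (hP : ∀ p : PlaqY x.toKIdx, ‖((holY x.toKIdx U p : (Matrix (Fin N) (Fin N) ℂ)ˣ) : Matrix (Fin N) (Fin N) ℂ) - 1‖ ≤
      Θ * ((((kGeo x.toKIdx).L) ^ (levV1 x.toKIdx p.src - 1))⁻¹) ^ 2)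
    (y : Site (PV d ℓ x.m x.K hd hL) 0) (μ ν : Fin (PV d ℓ x.m x.K hd hL).d) :
    ‖(plaqV U y μ ν : Matrix (Fin N) (Fin N) ℂ) - 1‖ ≤ Θ * (((ℓ + 1 : ℕ) : ℝ)) * ((((ℓ + 1 : ℕ) : ℝ)) ^ levY x.toKIdx (chartY x.toKIdx y))⁻¹ :=
  plaqV_binder_of_levelled x.toKIdx (contractive_of_regYP335 x hG h) hΘ hP y μ ν

end Member

/-! ## §3 (v1.1, gen 23) `hF` DERIVED at print's class: n06-j's levelled bound plugged in; the member-UNIFORM budget under the regime `M·α₀ ≤ a₀`;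
## the R-generic member-∀ form in the N06 certificate's binder shape

TRIGGER.  §4 of n06-j's `B9Eq335CoveragePAtLettersY` (`norm_holY_sub_one_le_levelled_of_regYP335(_c35Y)`, v1.1 p633293, re-served after the doc-only v1.2
p666681) is importable again, so the composition announced in this file's header lands as declarations.
WHAT §3 PROVES (sorry-free; 0 `def`; nothing of [B9] asserted).
* `K_nonneg` (`L ≥ 0`, `K := 10L·(M·α₀) ≥ 0`, `Θ(K) := 2K(1+K)e^{4K} ≥ 0` for `α₀ ≥ 0`); `contractive_of_memOfFam` (links contracting at a class-parametric carrier `bg9YR (M_N(ℂ)) G R₁ R₂` from the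
  class axiom `MemOfFam G R₁`, `G ≤ U(N)`).
* ★★ `plaqV_binder_of_regYP335` (`c ≤ 10`, `α₀ ≥ 0`, `U` in def-Y's member class over PRINT's cube class): `‖plaqV U y μ ν − 1‖ ≤ Θ(K)·L·(L^{levY (chartY y)})⁻¹` with the
  member's OWN `K = 10L·(M·α₀)` — the J-letter's `hF` with `ϑF := Θ(K)·L`; `…_c35Y` at MODULE 4's letter.
* ★ `thetaL_le_of_regime` (`α₀ ≥ 0`, `M·α₀ ≤ a₀ ⇒ Θ(10L·(M·α₀))·L ≤ Θ(10L·a₀)·L` — n06-j's `plaqBound_mono`); ★★ `plaqV_binder_of_regYP335_budget` (member-UNIFORM: ANY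
  displayed `ϑF ≥ Θ(10L·a₀)·L` is a plaquette binder for every member under its regime premise `M·α₀ ≤ a₀`).
* ★★★ **`plaqV_binder_of_regYR_budget`** — THE N06 CERTIFICATE's BINDER `hF` (dag-n06-d editions 45∕46; this seat's `Thm/…N06HolderPinsGradedAtRecord` (R3)∕(R4)):
  `∀ x, M₀ ≤ M → ∀ α₀ > 0, M·α₀ ≤ a₀ → ∀ U, Reg335 c α₀ U → Reg336 c α₀ U → ∀ y μ′ ν′, ‖plaqV U y μ′ ν′ − 1‖ ≤ ϑF·(L^{levY (chartY y)})⁻¹` over `bg9YR (M_N(ℂ)) G R₁ R₂`,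
  PROVED from the edition's OWN class axioms `hGR : MemOfFam G R₁` and `hRP1 : Reg335 c α₀ U → 0 ≤ α₀ ∧ (bg9YP … x).Reg335 c35Y α₀ U` (the first two of
  `N06PrintClassAxioms.printClass_axioms`) plus ONE displayed budget inequality `Θ(10L·a₀)·L ≤ ϑF`; `plaqV_binder_of_regYR_budget_SU` its `G = SU(N)` reading
  (`[NeZero N]`, `specialUnitaryUnits_le_unitaryUnits`); `budget_nonneg` (the record's `0 ≤ ϑF` from the budget, `a₀ ≥ 0`).  ⇒ at the P-edition `hF` is no longer a
  displayed input: `hF := plaqV_binder_of_regYR_budget_SU hGR c hRP1 hϑF`, `hϑF₀ := budget_nonneg ha₀ hϑF`.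
DECLARED READINGS.  As in §2; the regime premise `(geo9Y x).M * α₀ ≤ a₀` is read at `(kGeo x.toKIdx).M` (the same term, `geo9Y_M`); `M₀ ≤ M` and `Reg336` are carried
unused (binder shape of the certificate).  [cite: Balaban1985BackgroundPropagators, (3.69) p.404 with (3.35) p.396; Thm 3.1 p.397 («0 < α₀ ≦ α₁»)] -/

section Derived

open scoped Matrix.Norms.L2Operator
open B9BackgroundsKLevelV1R (RegFamY bg9YR MemOfFam mem_of_reg335R)
open B9Eq335CoveragePAtLettersY (plaqBound_mono norm_holY_sub_one_le_levelled_of_regYP335 norm_holY_sub_one_le_levelled_of_regYP335_c35Y)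
open B7Prop2SpecialUnitary (specialUnitaryUnits specialUnitaryUnits_le_unitaryUnits)

variable {d ℓ : ℕ} {hd : 1 ≤ d + 1} {hL : Odd (ℓ + 1) ∧ 1 < ℓ + 1} {b₀ b₁ : ℝ} {Mstar N : ℕ}

/-- the member's letters `L ≥ 0`, `K = 10L·(M·α₀) ≥ 0` and print's plaquette constant `Θ(K) = 2K(1+K)e^{4K} ≥ 0`, for `α₀ ≥ 0` (the generic `K ≥ 0 ⇒ Θ(K) ≥ 0` is
dag-n06-w1's `B9Eq346SecondLegAtCubesTorusL2Closed.windowConst_nonneg`, not restated). [cite: Balaban1985BackgroundPropagators, p.396 («O(1)M is a size of □»), (3.69) p.404, arithmetic] -/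
theorem K_nonneg (x : MemberY d ℓ hd hL b₀ b₁ Mstar) {α₀ : ℝ} (hα₀ : 0 ≤ α₀) :
    0 ≤ (kGeo x.toKIdx).L ∧ 0 ≤ 10 * (kGeo x.toKIdx).L * ((kGeo x.toKIdx).M * α₀) ∧
      0 ≤ 2 * (10 * (kGeo x.toKIdx).L * ((kGeo x.toKIdx).M * α₀)) * (1 + 10 * (kGeo x.toKIdx).L * ((kGeo x.toKIdx).M * α₀)) *
        Real.exp (4 * (10 * (kGeo x.toKIdx).L * ((kGeo x.toKIdx).M * α₀))) := by
  have hL0 : (0 : ℝ) ≤ (kGeo x.toKIdx).L := by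
    show (0 : ℝ) ≤ ((ℓ + 1 : ℕ) : ℝ)
    positivity
  have hM0 : (0 : ℝ) ≤ (kGeo x.toKIdx).M := by
    show (0 : ℝ) ≤ ((ℓ + 1 : ℕ) : ℝ) * (x.toKIdx.Mh : ℝ)
    positivity
  have hK : 0 ≤ 10 * (kGeo x.toKIdx).L * ((kGeo x.toKIdx).M * α₀) := mul_nonneg (mul_nonneg (by norm_num) hL0) (mul_nonneg hM0 hα₀)
  have key : ∀ {K : ℝ}, 0 ≤ K → 0 ≤ 2 * K * (1 + K) * Real.exp (4 * K) := fun {K} hK' => by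
    have := Real.exp_pos (4 * K)
    positivity
  exact ⟨hL0, hK, key hK⟩

/-- the links of a configuration in a `G`-VALUED regularity family (class axiom `MemOfFam G R₁`, `G ≤ U(N)`) are contractions — the R-generic reading of §2's
`contractive_of_regYP335`. [cite: Balaban1985BackgroundPropagators, (3.35) p.396 («U with values in G»), bookkeeping] -/
theorem contractive_of_memOfFam [Nonempty (Fin N)] {R₁ R₂ : RegFamY d ℓ hd hL b₀ b₁ Mstar (Matrix (Fin N) (Fin N) ℂ)}
    {G : Subgroup (Matrix (Fin N) (Fin N) ℂ)ˣ} (hG : G ≤ B7Prop2Explicit.unitaryUnits (Matrix (Fin N) (Fin N) ℂ)) (hGR : MemOfFam G R₁)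
    (x : MemberY d ℓ hd hL b₀ b₁ Mstar) {c α₀ : ℝ} {U : (bg9YR (Matrix (Fin N) (Fin N) ℂ) G R₁ R₂ x).Cfg}
    (h : (bg9YR (Matrix (Fin N) (Fin N) ℂ) G R₁ R₂ x).Reg335 c α₀ U) (ν : Fin (d + 1)) (y : Site (PV d ℓ x.m x.K hd hL) 0) :
    ‖(U ν y : Matrix (Fin N) (Fin N) ℂ)‖ ≤ 1 ∧ ‖(((U ν y)⁻¹ : (Matrix (Fin N) (Fin N) ℂ)ˣ) : Matrix (Fin N) (Fin N) ℂ)‖ ≤ 1 := by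
  have hUG : U ν y ∈ G := mem_of_reg335R hGR x h ν y
  exact ⟨(CStarRing.norm_of_mem_unitary (B7Prop2Explicit.mem_unitaryUnits.1 (hG hUG))).le,
    (CStarRing.norm_of_mem_unitary (B7Prop2Explicit.mem_unitaryUnits.1 (hG (G.inv_mem hUG)))).le⟩

/-- ★★ **`hF` WITH THE MEMBER's OWN CONSTANT, DERIVED**: for `U` in def-Y's member class over PRINT's cube class `(bg9YP (M_N(ℂ)) G x).Reg335 c α₀` (`c ≤ 10`, `α₀ ≥ 0`,
`G ≤ U(N)`), every ordered pair of directions at every site has `‖plaqV U y μ ν − 1‖ ≤ Θ(K)·L·(L^{levY (chartY y)})⁻¹`, `Θ(K) = 2K(1+K)e^{4K}`, `K = 10L·(M·α₀)` — §2 composed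
with n06-j's `norm_holY_sub_one_le_levelled_of_regYP335`. [cite: Balaban1985BackgroundPropagators, (3.69) p.404, (3.35) p.396] -/
theorem plaqV_binder_of_regYP335 [Nonempty (Fin N)] (x : MemberY d ℓ hd hL b₀ b₁ Mstar) {G : Subgroup (Matrix (Fin N) (Fin N) ℂ)ˣ}
    (hG : G ≤ B7Prop2Explicit.unitaryUnits (Matrix (Fin N) (Fin N) ℂ)) {U : (bg9YP (Matrix (Fin N) (Fin N) ℂ) G x).Cfg} {c α₀ : ℝ}
    (hc : c ≤ 10) (hα₀ : 0 ≤ α₀) (h : (bg9YP (Matrix (Fin N) (Fin N) ℂ) G x).Reg335 c α₀ U)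
    (y : Site (PV d ℓ x.m x.K hd hL) 0) (μ ν : Fin (PV d ℓ x.m x.K hd hL).d) :
    ‖(plaqV U y μ ν : Matrix (Fin N) (Fin N) ℂ) - 1‖ ≤
      2 * (10 * (kGeo x.toKIdx).L * ((kGeo x.toKIdx).M * α₀)) * (1 + 10 * (kGeo x.toKIdx).L * ((kGeo x.toKIdx).M * α₀)) *
          Real.exp (4 * (10 * (kGeo x.toKIdx).L * ((kGeo x.toKIdx).M * α₀)))
        * (((ℓ + 1 : ℕ) : ℝ)) * ((((ℓ + 1 : ℕ) : ℝ)) ^ levY x.toKIdx (chartY x.toKIdx y))⁻¹ :=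
  plaqV_binder_of_regYP335_levelled x hG h (K_nonneg x hα₀).2.2 (norm_holY_sub_one_le_levelled_of_regYP335 x hc hα₀ h) y μ ν

/-- ★ the same at the N06 certificate's literal premise `(bg9YP … x).Reg335 c35Y α₀ U` (MODULE 4's `c35Y = 10`).
[cite: Balaban1985BackgroundPropagators, (3.69) p.404, (3.35) p.396 («≧ 10»)] -/
theorem plaqV_binder_of_regYP335_c35Y [Nonempty (Fin N)] (x : MemberY d ℓ hd hL b₀ b₁ Mstar) {G : Subgroup (Matrix (Fin N) (Fin N) ℂ)ˣ}
    (hG : G ≤ B7Prop2Explicit.unitaryUnits (Matrix (Fin N) (Fin N) ℂ)) {U : (bg9YP (Matrix (Fin N) (Fin N) ℂ) G x).Cfg} {α₀ : ℝ}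
    (hα₀ : 0 ≤ α₀) (h : (bg9YP (Matrix (Fin N) (Fin N) ℂ) G x).Reg335 c35Y α₀ U)
    (y : Site (PV d ℓ x.m x.K hd hL) 0) (μ ν : Fin (PV d ℓ x.m x.K hd hL).d) :
    ‖(plaqV U y μ ν : Matrix (Fin N) (Fin N) ℂ) - 1‖ ≤
      2 * (10 * (kGeo x.toKIdx).L * ((kGeo x.toKIdx).M * α₀)) * (1 + 10 * (kGeo x.toKIdx).L * ((kGeo x.toKIdx).M * α₀)) *
          Real.exp (4 * (10 * (kGeo x.toKIdx).L * ((kGeo x.toKIdx).M * α₀)))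
        * (((ℓ + 1 : ℕ) : ℝ)) * ((((ℓ + 1 : ℕ) : ℝ)) ^ levY x.toKIdx (chartY x.toKIdx y))⁻¹ :=
  plaqV_binder_of_regYP335 x hG (by norm_num [c35Y]) hα₀ h y μ ν

/-- ★ **THE REGIME MONOTONICITY**: for `α₀ ≥ 0` and the certificate's regime premise `M·α₀ ≤ a₀`, the member's plaquette constant is below the member-UNIFORM one,
`Θ(10L·(M·α₀))·L ≤ Θ(10L·a₀)·L` (`Θ` increasing on `[0, ∞)`, n06-j's `plaqBound_mono`). [cite: Balaban1985BackgroundPropagators, Thm 3.1 p.397 («0 < α₀ ≦ α₁»), p.409 («α₀ so small that O(1)Mα₀ is still sufficiently small»), arithmetic] -/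
theorem thetaL_le_of_regime (x : MemberY d ℓ hd hL b₀ b₁ Mstar) {α₀ a₀ : ℝ} (hα₀ : 0 ≤ α₀) (ha : (geo9Y x).M * α₀ ≤ a₀) :
    2 * (10 * (kGeo x.toKIdx).L * ((kGeo x.toKIdx).M * α₀)) * (1 + 10 * (kGeo x.toKIdx).L * ((kGeo x.toKIdx).M * α₀)) *
          Real.exp (4 * (10 * (kGeo x.toKIdx).L * ((kGeo x.toKIdx).M * α₀))) * (((ℓ + 1 : ℕ) : ℝ)) ≤
      2 * (10 * (((ℓ + 1 : ℕ) : ℝ)) * a₀) * (1 + 10 * (((ℓ + 1 : ℕ) : ℝ)) * a₀) * Real.exp (4 * (10 * (((ℓ + 1 : ℕ) : ℝ)) * a₀)) * (((ℓ + 1 : ℕ) : ℝ)) := by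
  obtain ⟨hL0, hK, -⟩ := K_nonneg x hα₀
  have hMa : (kGeo x.toKIdx).M * α₀ ≤ a₀ := ha
  have hKK : 10 * (kGeo x.toKIdx).L * ((kGeo x.toKIdx).M * α₀) ≤ 10 * (((ℓ + 1 : ℕ) : ℝ)) * a₀ :=
    mul_le_mul_of_nonneg_left hMa (mul_nonneg (by norm_num) hL0)
  exact mul_le_mul_of_nonneg_right (plaqBound_mono hK hKK) hL0

/-- ★★ **`hF` MEMBER-UNIFORM, DERIVED (budget form at print's class)**: under the certificate's regime premise `M·α₀ ≤ a₀` (`α₀ ≥ 0`, `c ≤ 10`, `G ≤ U(N)`), ANY displayed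
`ϑF ≥ Θ(10L·a₀)·L` is a plaquette binder: `‖plaqV U y μ ν − 1‖ ≤ ϑF·(L^{levY (chartY y)})⁻¹` at every ordered pair, for every member.
[cite: Balaban1985BackgroundPropagators, (3.69) p.404, (3.35) p.396, Thm 3.1 p.397] -/
theorem plaqV_binder_of_regYP335_budget [Nonempty (Fin N)] (x : MemberY d ℓ hd hL b₀ b₁ Mstar) {G : Subgroup (Matrix (Fin N) (Fin N) ℂ)ˣ}
    (hG : G ≤ B7Prop2Explicit.unitaryUnits (Matrix (Fin N) (Fin N) ℂ)) {U : (bg9YP (Matrix (Fin N) (Fin N) ℂ) G x).Cfg} {c α₀ a₀ ϑF : ℝ}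
    (hc : c ≤ 10) (hα₀ : 0 ≤ α₀) (ha : (geo9Y x).M * α₀ ≤ a₀)
    (hϑF : 2 * (10 * (((ℓ + 1 : ℕ) : ℝ)) * a₀) * (1 + 10 * (((ℓ + 1 : ℕ) : ℝ)) * a₀) * Real.exp (4 * (10 * (((ℓ + 1 : ℕ) : ℝ)) * a₀)) * (((ℓ + 1 : ℕ) : ℝ)) ≤ ϑF)
    (h : (bg9YP (Matrix (Fin N) (Fin N) ℂ) G x).Reg335 c α₀ U)
    (y : Site (PV d ℓ x.m x.K hd hL) 0) (μ ν : Fin (PV d ℓ x.m x.K hd hL).d) :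
    ‖(plaqV U y μ ν : Matrix (Fin N) (Fin N) ℂ) - 1‖ ≤ ϑF * ((((ℓ + 1 : ℕ) : ℝ)) ^ levY x.toKIdx (chartY x.toKIdx y))⁻¹ := by
  have hX : 0 ≤ ((((ℓ + 1 : ℕ) : ℝ)) ^ levY x.toKIdx (chartY x.toKIdx y))⁻¹ := by positivity
  exact (plaqV_binder_of_regYP335 x hG hc hα₀ h y μ ν).trans (mul_le_mul_of_nonneg_right ((thetaL_le_of_regime x hα₀ ha).trans hϑF) hX)

/-- ★★★ **THE N06 CERTIFICATE's PLAQUETTE BINDER `hF`, DERIVED AT THE R-GENERIC P-EDITION** — in the binder shape of dag-n06-d's editions 45∕46 and of this seat's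
`Thm/…N06HolderPinsGradedAtRecord` (member-∀ under the regime premises, class-parametric carrier `bg9YR (M_N(ℂ)) G R₁ R₂`, `G ≤ U(N)`), from the edition's OWN class
axioms `hGR : MemOfFam G R₁` («U with values in G») and `hRP1` («the class IS (3.35) over print's cube class at O(1) = 10, with the sign of α₀») plus ONE displayed
budget inequality `Θ(10L·a₀)·L ≤ ϑF`: `∀ x, M₀ ≤ M → ∀ α₀ > 0, M·α₀ ≤ a₀ → ∀ U, Reg335 c α₀ U → Reg336 c α₀ U → ∀ y μ′ ν′, ‖plaqV U y μ′ ν′ − 1‖ ≤ ϑF·(L^{levY (chartY y)})⁻¹`.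
(`M₀ ≤ M` and `Reg336` are carried unused.) [cite: Balaban1985BackgroundPropagators, (3.69) p.404 («follow directly from the assumptions (3.35)»), (3.35) p.396, Thm 3.1 p.397] -/
theorem plaqV_binder_of_regYR_budget [Nonempty (Fin N)] {R₁ R₂ : RegFamY d ℓ hd hL b₀ b₁ Mstar (Matrix (Fin N) (Fin N) ℂ)}
    {G : Subgroup (Matrix (Fin N) (Fin N) ℂ)ˣ} (hG : G ≤ B7Prop2Explicit.unitaryUnits (Matrix (Fin N) (Fin N) ℂ)) (hGR : MemOfFam G R₁) (c : ℝ)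
    (hRP1 : ∀ (x : MemberY d ℓ hd hL b₀ b₁ Mstar) (α₀ : ℝ) (U : (bg9YR (Matrix (Fin N) (Fin N) ℂ) G R₁ R₂ x).Cfg),
      (bg9YR (Matrix (Fin N) (Fin N) ℂ) G R₁ R₂ x).Reg335 c α₀ U → 0 ≤ α₀ ∧ (bg9YP (Matrix (Fin N) (Fin N) ℂ) G x).Reg335 c35Y α₀ U)
    {M₀ a₀ ϑF : ℝ}
    (hϑF : 2 * (10 * (((ℓ + 1 : ℕ) : ℝ)) * a₀) * (1 + 10 * (((ℓ + 1 : ℕ) : ℝ)) * a₀) * Real.exp (4 * (10 * (((ℓ + 1 : ℕ) : ℝ)) * a₀)) * (((ℓ + 1 : ℕ) : ℝ)) ≤ ϑF) :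
    ∀ x : MemberY d ℓ hd hL b₀ b₁ Mstar, M₀ ≤ (geo9Y x).M → ∀ α₀ : ℝ, 0 < α₀ → (geo9Y x).M * α₀ ≤ a₀ →
      ∀ U : (bg9YR (Matrix (Fin N) (Fin N) ℂ) G R₁ R₂ x).Cfg, (bg9YR (Matrix (Fin N) (Fin N) ℂ) G R₁ R₂ x).Reg335 c α₀ U →
        (bg9YR (Matrix (Fin N) (Fin N) ℂ) G R₁ R₂ x).Reg336 c α₀ U → ∀ (y : Site (PV d ℓ x.m x.K hd hL) 0) (μ' ν' : Fin (d + 1)),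
          ‖(plaqV U y μ' ν' : Matrix (Fin N) (Fin N) ℂ) - 1‖ ≤ ϑF * (((((ℓ + 1 : ℕ) : ℝ)) ^ levY x.toKIdx (chartY x.toKIdx y))⁻¹) :=
  fun x _ α₀ _ ha U hU _ y μ' ν' => by
    obtain ⟨hα₀, hP⟩ := hRP1 x α₀ U hU
    -- the levelled bound at print's class (n06-j), §1's shape lemma with the R-class contractivity, then the regime budget
    have h1 := plaqV_binder_of_levelled x.toKIdx (contractive_of_memOfFam hG hGR x hU) (K_nonneg x hα₀).2.2
      (norm_holY_sub_one_le_levelled_of_regYP335_c35Y x hα₀ hP) y μ' ν'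
    have hX : 0 ≤ ((((ℓ + 1 : ℕ) : ℝ)) ^ levY x.toKIdx (chartY x.toKIdx y))⁻¹ := by positivity
    exact h1.trans (mul_le_mul_of_nonneg_right ((thetaL_le_of_regime x hα₀ ha).trans hϑF) hX)

/-- ★★★ the `G = SU(N)` reading of `plaqV_binder_of_regYR_budget` (the certificate's literal group, `hGR : MemOfFam SU(N) R₁`; `SU(N) ≤ U(N)`): the knit's displayed
input `hF` becomes `plaqV_binder_of_regYR_budget_SU hGR c hRP1 hϑF`. [cite: Balaban1985BackgroundPropagators, (3.69) p.404, (3.35) p.396 («U with values in G»), (3.3) p.391] -/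
theorem plaqV_binder_of_regYR_budget_SU [NeZero N] {R₁ R₂ : RegFamY d ℓ hd hL b₀ b₁ Mstar (Matrix (Fin N) (Fin N) ℂ)}
    (hGR : MemOfFam (specialUnitaryUnits (Fin N)) R₁) (c : ℝ)
    (hRP1 : ∀ (x : MemberY d ℓ hd hL b₀ b₁ Mstar) (α₀ : ℝ) (U : (bg9YR (Matrix (Fin N) (Fin N) ℂ) (specialUnitaryUnits (Fin N)) R₁ R₂ x).Cfg),
      (bg9YR (Matrix (Fin N) (Fin N) ℂ) (specialUnitaryUnits (Fin N)) R₁ R₂ x).Reg335 c α₀ U →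
        0 ≤ α₀ ∧ (bg9YP (Matrix (Fin N) (Fin N) ℂ) (specialUnitaryUnits (Fin N)) x).Reg335 c35Y α₀ U)
    {M₀ a₀ ϑF : ℝ}
    (hϑF : 2 * (10 * (((ℓ + 1 : ℕ) : ℝ)) * a₀) * (1 + 10 * (((ℓ + 1 : ℕ) : ℝ)) * a₀) * Real.exp (4 * (10 * (((ℓ + 1 : ℕ) : ℝ)) * a₀)) * (((ℓ + 1 : ℕ) : ℝ)) ≤ ϑF) :
    ∀ x : MemberY d ℓ hd hL b₀ b₁ Mstar, M₀ ≤ (geo9Y x).M → ∀ α₀ : ℝ, 0 < α₀ → (geo9Y x).M * α₀ ≤ a₀ →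
      ∀ U : (bg9YR (Matrix (Fin N) (Fin N) ℂ) (specialUnitaryUnits (Fin N)) R₁ R₂ x).Cfg,
        (bg9YR (Matrix (Fin N) (Fin N) ℂ) (specialUnitaryUnits (Fin N)) R₁ R₂ x).Reg335 c α₀ U →
        (bg9YR (Matrix (Fin N) (Fin N) ℂ) (specialUnitaryUnits (Fin N)) R₁ R₂ x).Reg336 c α₀ U → ∀ (y : Site (PV d ℓ x.m x.K hd hL) 0) (μ' ν' : Fin (d + 1)),
          ‖(plaqV U y μ' ν' : Matrix (Fin N) (Fin N) ℂ) - 1‖ ≤ ϑF * (((((ℓ + 1 : ℕ) : ℝ)) ^ levY x.toKIdx (chartY x.toKIdx y))⁻¹) :=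
  plaqV_binder_of_regYR_budget specialUnitaryUnits_le_unitaryUnits hGR c hRP1 hϑF

/-- the record's sign binder `hϑF : 0 ≤ ϑF` follows from the budget inequality for `a₀ ≥ 0` (so the knit displays the budget ONLY).
[cite: Balaban1985BackgroundPropagators, (3.69) p.404 («O(1)Mα₀»), arithmetic] -/
theorem budget_nonneg {a₀ ϑF : ℝ} (ha₀ : 0 ≤ a₀)
    (hϑF : 2 * (10 * (((ℓ + 1 : ℕ) : ℝ)) * a₀) * (1 + 10 * (((ℓ + 1 : ℕ) : ℝ)) * a₀) * Real.exp (4 * (10 * (((ℓ + 1 : ℕ) : ℝ)) * a₀)) * (((ℓ + 1 : ℕ) : ℝ)) ≤ ϑF) :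
    0 ≤ ϑF := by
  have := Real.exp_pos (4 * (10 * (((ℓ + 1 : ℕ) : ℝ)) * a₀))
  exact le_trans (by positivity) hϑF

end Derived

end Literature.MathematicalPhysics.QuantumFieldTheory.Balaban1983to89.B9PlaquetteBinderOfReg335Y
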